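import Summits.KontsevichZagierPeriods.KontsevichZagierPeriods.Theorems.EllipticMomentKernel.Negative.GeneralCurve
import Literature.NumberTheory.Transcendental.KZSemialgebraicComplex

/-!
# `EllipticMomentKernel` (stmt-KontsevichZagierPeriods-10631) — negative knowledge, part 8: the registered skeleton's stubs (cycle 2 targets) and the general-curve legality kit

Standing-adversary findings on the four active stubs of the registered skeleton `a5aa6383`
(line `hermite-coordinates-hom`): none is killable. `stub_basisReps` is PROVED here WITHOUT its
`Rigid` hypothesis (`basisReps_of_disc_pos`: the hypothesis is decoration). For the move chains of
`stub_polynomialToConstant` / `stub_hermiteReduction` (rule 3 over the base `ℝ⁰` with the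
irrational algebraic bounds `e₃, e₂`, then rule 1a across the branch points) this file supplies the
legality kit for EVERY admissible parameter, with no Tarski–Seidenberg and no isolating formula:
the roots and the constants `R(e₂) − R(e₃)` (`R ∈ ℚ[X]`) are real algebraic
(`isAlgebraic_of_cubic_eq_zero`, `isAlgebraic_aeval_sub_aeval`), the Hermite band
`closedBandQ e₃ e₂` (literal `KZ.newtonLeibnizRel` shape) equals `σ ∪ endsQ e₃ e₂` with `endsQ`
Lebesgue-null and `ℚ`-semialgebraic, the band is `ℚ`-semialgebraic, and the constant bounds are
`ℚ`-semialgebraic functions on `univ ⊆ ℝ⁰` (`isSemialgebraicFunOn_const_root`); finally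
`roots_located`: ordered roots of the factored cubic are separated by `∓√(q₂/12)`. [folklore]
-/

noncomputable section

open MeasureTheory Set
open scoped BigOperators

namespace Summit.KontsevichZagierPeriods.HermiteRigidity.EllipticMomentKernelNegative

open Literature.NumberTheory.Transcendental
open Literature.NumberTheory.Transcendental.KZ

section Targets

open Literature.ModelTheory.ExponentialFields (IsSemialgebraic isSemialgebraic_setOf_eval_pos
  isSemialgebraic_setOf_eval_eq_zero isSemialgebraic_univ)
open MvPolynomial (aeval X C)

variable {q₂ q₃ : ℚ}

/-- `stub_basisReps` of skeleton `a5aa6383` WITHOUT its hypothesis `hR : Rigid q₂ q₃`: the two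
transcendental normal forms `[σ, 1/√f]`, `[σ, x/√f]` exist as honest representations for every
admissible parameter (`genRepQ h 0`, `genRepQ h 1`). So `hR` is decoration in that stub. [folklore] -/
theorem basisReps_of_disc_pos (h : 0 < disc q₂ q₃) :
    ∃ b₀ b₁ : IntegralRep 1, b₀.domain = oval q₂ q₃ ∧
      EqOn b₀.integrand (fun p => 1 / Real.sqrt (cubic q₂ q₃ (p 0))) (oval q₂ q₃) ∧
      b₁.domain = oval q₂ q₃ ∧
      EqOn b₁.integrand (fun p => p 0 / Real.sqrt (cubic q₂ q₃ (p 0))) (oval q₂ q₃) :=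
  ⟨genRepQ h 0, genRepQ h 1, rfl, fun p _ => by simp [genRepQ], rfl, fun p _ => by simp [genRepQ]⟩

/-- Roots of the cubic are real algebraic numbers (the cubic is a non-zero `ℚ`-polynomial).
[folklore] -/
theorem isAlgebraic_of_cubic_eq_zero {e : ℝ} (he : cubic q₂ q₃ e = 0) : IsAlgebraic ℚ e := by
  refine ⟨4 * Polynomial.X ^ 3 - Polynomial.C q₂ * Polynomial.X - Polynomial.C q₃, ?_, ?_⟩
  · intro h0
    have h3 := congrArg (fun p : Polynomial ℚ => p.coeff 3) h0
    simp only [Polynomial.coeff_sub, Polynomial.coeff_C_mul,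
      Polynomial.coeff_X, Polynomial.coeff_C, Polynomial.coeff_zero] at h3
    norm_num at h3
  · unfold cubic at he
    simp only [map_sub, map_mul, map_pow, Polynomial.aeval_X, Polynomial.aeval_C, eq_ratCast]
    have h4 : (Polynomial.aeval e) (4 : Polynomial ℚ) = (4 : ℝ) := map_ofNat _ 4
    rw [h4]
    linarith

/-- Polynomial expressions in an algebraic number are algebraic. [folklore] -/
theorem isAlgebraic_aeval_of_isAlgebraic {e : ℝ} (he : IsAlgebraic ℚ e) (R : Polynomial ℚ) :
    IsAlgebraic ℚ (Polynomial.aeval e R) := by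
  rw [isAlgebraic_iff_isIntegral] at he ⊢
  induction R using Polynomial.induction_on' with
  | add p q hp hq => simpa [map_add] using hp.add hq
  | monomial n a =>
    rw [← Polynomial.C_mul_X_pow_eq_monomial, map_mul, map_pow, Polynomial.aeval_C,
      Polynomial.aeval_X]
    exact isIntegral_algebraMap.mul (he.pow n)

/-- The constant produced by the `b`-odd branch / `stub_polynomialToConstant`,
`R(e₂) − R(e₃)` with `R ∈ ℚ[X]`, is real algebraic (so `[pt, R(e₂) − R(e₃)]` is a legal
`IntegralRep 0` by `isSemialgebraicFunOn_const_of_isAlgebraic`). [folklore] -/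
theorem isAlgebraic_aeval_sub_aeval {e₃ e₂ : ℝ} (h₃ : cubic q₂ q₃ e₃ = 0) (h₂ : cubic q₂ q₃ e₂ = 0)
    (R : Polynomial ℚ) : IsAlgebraic ℚ (Polynomial.aeval e₂ R - Polynomial.aeval e₃ R) := by
  have h := (isAlgebraic_aeval_of_isAlgebraic (isAlgebraic_of_cubic_eq_zero h₂) R)
  have h' := (isAlgebraic_aeval_of_isAlgebraic (isAlgebraic_of_cubic_eq_zero h₃) R)
  rw [isAlgebraic_iff_isIntegral] at h h' ⊢
  exact h.sub h'

/-- The three roots are the only zeros of the factored cubic. [folklore] -/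
theorem eq_roots_of_cubic_eq_zero {e₃ e₂ e₁ y : ℝ}
    (hf : ∀ x, cubic q₂ q₃ x = 4 * (x - e₃) * (x - e₂) * (x - e₁)) (hy : cubic q₂ q₃ y = 0) :
    y = e₃ ∨ y = e₂ ∨ y = e₁ := by
  rw [hf] at hy
  rcases mul_eq_zero.1 hy with h | h
  · rcases mul_eq_zero.1 h with h | h
    · rcases mul_eq_zero.1 h with h | h
      · norm_num at h
      · exact Or.inl (by linarith)
    · exact Or.inr (Or.inl (by linarith))
  · exact Or.inr (Or.inr (by linarith))

/-- The roots of the factored cubic are roots. [folklore] -/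
theorem cubic_roots_eq_zero {e₃ e₂ e₁ : ℝ}
    (hf : ∀ x, cubic q₂ q₃ x = 4 * (x - e₃) * (x - e₂) * (x - e₁)) :
    cubic q₂ q₃ e₃ = 0 ∧ cubic q₂ q₃ e₂ = 0 ∧ cubic q₂ q₃ e₁ = 0 := by
  refine ⟨?_, ?_, ?_⟩ <;> rw [hf] <;> ring

/-- The two branch points `{e₃, e₂} ⊆ ℝ¹` bounding the oval. [folklore] -/
def endsQ (e₃ e₂ : ℝ) : Set (Fin 1 → ℝ) := {z | z 0 = e₃ ∨ z 0 = e₂}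

/-- The CLOSED band `[e₃, e₂] ⊆ ℝ¹` in the literal shape of `KZ.newtonLeibnizRel` over the base
`univ ⊆ ℝ⁰` with the constant (real algebraic, in general irrational) bounds `a = e₃`, `b = e₂` —
the band of the Hermite move (`stub_hermiteReduction`) and of `stub_polynomialToConstant`.
[folklore] -/
def closedBandQ (e₃ e₂ : ℝ) : Set (Fin 1 → ℝ) :=
  {z | (Fin.init z : Fin 0 → ℝ) ∈ (univ : Set (Fin 0 → ℝ)) ∧
    (fun _ => e₃) (Fin.init z) ≤ z (Fin.last 0) ∧ z (Fin.last 0) ≤ (fun _ => e₂) (Fin.init z)}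

/-- `closedBandQ e₃ e₂ = [e₃, e₂]`. [folklore] -/
theorem closedBandQ_eq (e₃ e₂ : ℝ) : closedBandQ e₃ e₂ = {z : Fin 1 → ℝ | e₃ ≤ z 0 ∧ z 0 ≤ e₂} := by
  ext z; simp [closedBandQ]

/-- `[e₃, e₂] = σ ∪ {e₃, e₂}` for the factored cubic. [folklore] -/
theorem closedBandQ_eq_union {e₃ e₂ e₁ : ℝ} (h32 : e₃ < e₂) (h21 : e₂ < e₁)
    (hf : ∀ x, cubic q₂ q₃ x = 4 * (x - e₃) * (x - e₂) * (x - e₁)) :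
    closedBandQ e₃ e₂ = oval q₂ q₃ ∪ endsQ e₃ e₂ := by
  rw [closedBandQ_eq, oval_eq_of_roots h32 h21 hf]
  ext z
  simp only [mem_setOf_eq, mem_union, endsQ, mem_Ioo]
  constructor
  · rintro ⟨h1, h2⟩
    rcases h1.lt_or_eq with h1 | h1
    · rcases h2.lt_or_eq with h2 | h2
      · exact Or.inl ⟨h1, h2⟩
      · exact Or.inr (Or.inr h2)
    · exact Or.inr (Or.inl h1.symm)
  · rintro (⟨h1, h2⟩ | h | h)
    · exact ⟨h1.le, h2.le⟩
    · rw [h]; exact ⟨le_rfl, h32.le⟩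
    · rw [h]; exact ⟨h32.le, le_rfl⟩

/-- `σ` and the branch points are disjoint. [folklore] -/
theorem oval_inter_endsQ {e₃ e₂ e₁ : ℝ} (h32 : e₃ < e₂) (h21 : e₂ < e₁)
    (hf : ∀ x, cubic q₂ q₃ x = 4 * (x - e₃) * (x - e₂) * (x - e₁)) :
    oval q₂ q₃ ∩ endsQ e₃ e₂ = ∅ := by
  rw [oval_eq_of_roots h32 h21 hf]
  ext z
  simp only [mem_inter_iff, mem_setOf_eq, mem_Ioo, endsQ, mem_empty_iff_false, iff_false]
  rintro ⟨⟨h1, h2⟩, h | h⟩ <;> rw [h] at h1 h2 <;> linarith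

/-- **The branch points are `ℚ`-semialgebraic for EVERY admissible parameter** — no
Tarski–Seidenberg and no explicit isolating formula needed: `e₃, e₂` are real algebraic
(`isAlgebraic_of_cubic_eq_zero`) and coordinate hyperplanes at real algebraic heights are
`ℚ`-definable (tree: `isSemialgebraic_setOf_apply_eq_of_isAlgebraic`). [folklore] -/
theorem isSemialgebraic_endsQ {e₃ e₂ : ℝ} (h₃ : cubic q₂ q₃ e₃ = 0) (h₂ : cubic q₂ q₃ e₂ = 0) :
    IsSemialgebraic ℚ (endsQ e₃ e₂) :=
  (isSemialgebraic_setOf_apply_eq_of_isAlgebraic (isAlgebraic_of_cubic_eq_zero h₃) (0 : Fin 1)).union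
    (isSemialgebraic_setOf_apply_eq_of_isAlgebraic (isAlgebraic_of_cubic_eq_zero h₂) (0 : Fin 1))

/-- The branch points form a two-point, hence Lebesgue-null, subset of `ℝ¹`. [folklore] -/
theorem volume_endsQ (e₃ e₂ : ℝ) : volume (endsQ e₃ e₂) = 0 := by
  have : endsQ e₃ e₂ = {fun _ => e₃, fun _ => e₂} := by
    ext z; simp [endsQ, funext_iff, Fin.forall_fin_one]
  rw [this]
  exact (Set.toFinite _).measure_zero _

/-- **The closed Hermite band `[e₃, e₂]` is `ℚ`-semialgebraic for every admissible parameter.**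
[folklore] -/
theorem isSemialgebraic_closedBandQ {e₃ e₂ e₁ : ℝ} (h32 : e₃ < e₂) (h21 : e₂ < e₁)
    (hf : ∀ x, cubic q₂ q₃ x = 4 * (x - e₃) * (x - e₂) * (x - e₁)) :
    IsSemialgebraic ℚ (closedBandQ e₃ e₂) := by
  obtain ⟨h₃, h₂, -⟩ := cubic_roots_eq_zero hf
  obtain ⟨hpos, -⟩ := cubic_sign_of_roots h32 h21 hf
  have hd : 0 < disc q₂ q₃ :=
    disc_pos_of_sign_change (x := (e₃ + e₂) / 2) (t := (e₂ + e₁) / 2) (by linarith)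
      (hpos _ ⟨by linarith, by linarith⟩)
      ((cubic_sign_of_roots h32 h21 hf).2 _ ⟨by linarith, by linarith⟩)
  rw [closedBandQ_eq_union h32 h21 hf]
  exact (isSemialgebraic_oval hd).union (isSemialgebraic_endsQ h₃ h₂)

/-- The bounds of the Hermite band are legal: the constant functions `e₃`, `e₂` on the base
`univ ⊆ ℝ⁰` are `ℚ`-semialgebraic (tree: `isSemialgebraicFunOn_const_of_isAlgebraic`). [folklore] -/
theorem isSemialgebraicFunOn_const_root {e : ℝ} (he : cubic q₂ q₃ e = 0) :
    IsSemialgebraicFunOn ℚ (univ : Set (Fin 0 → ℝ)) (fun _ => e) :=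
  isSemialgebraicFunOn_const_of_isAlgebraic isSemialgebraic_univ (isAlgebraic_of_cubic_eq_zero he)

/-- Three ordered roots are automatically LOCATED by the critical points `∓m`, `m = √(q₂/12)`:
`e₃ < −m < e₂ < m < e₁` (so the smoothstep-line stubs' `e₃ < e₂ < e₁` hypotheses and the output of
`exists_roots` are interchangeable). [folklore] -/
theorem roots_located {e₃ e₂ e₁ : ℝ} (h32 : e₃ < e₂) (h21 : e₂ < e₁)
    (hf : ∀ x, cubic q₂ q₃ x = 4 * (x - e₃) * (x - e₂) * (x - e₁)) :
    e₃ < -Real.sqrt (q₂ / 12) ∧ -Real.sqrt (q₂ / 12) < e₂ ∧ e₂ < Real.sqrt (q₂ / 12) ∧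
      Real.sqrt (q₂ / 12) < e₁ := by
  obtain ⟨hpos, hneg⟩ := cubic_sign_of_roots h32 h21 hf
  have hd : 0 < disc q₂ q₃ :=
    disc_pos_of_sign_change (x := (e₃ + e₂) / 2) (t := (e₂ + e₁) / 2) (by linarith)
      (hpos _ ⟨by linarith, by linarith⟩) (hneg _ ⟨by linarith, by linarith⟩)
  obtain ⟨hcm, hcp⟩ := cubic_crit hd
  set m := Real.sqrt (q₂ / 12) with hm
  have hm0 : 0 < m := Real.sqrt_pos.2 (by have := q₂_pos_of_disc_pos hd; positivity)
  -- `f(-m) > 0`: `-m ∈ (e₃, e₂)` or `-m > e₁`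
  have hneg_m : -m ∈ Ioo e₃ e₂ := by
    rcases mem_Ioo_or_gt_of_cubic_pos h32 h21 hf hcm with h | h
    · exact h
    · exfalso
      have : 0 < cubic q₂ q₃ m := cubic_pos_of_gt h32 h21 hf (by linarith)
      linarith
  -- `f(m) < 0`: `m ∉ [e₃, e₂] ∪ [e₁, ∞)`, and `m > -m > e₃`, so `m ∈ (e₂, e₁)`
  have hm_lt : m < e₁ := by
    by_contra hcon
    push Not at hcon
    rcases hcon.lt_or_eq with h | h
    · have := cubic_pos_of_gt h32 h21 hf h; linarith
    · have : cubic q₂ q₃ m = 0 := by rw [hf, ← h]; ring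
      linarith
  have hm_gt : e₂ < m := by
    by_contra hcon
    push Not at hcon
    rcases hcon.lt_or_eq with h | h
    · have : 0 < cubic q₂ q₃ m := hpos _ ⟨by linarith [hneg_m.1], h⟩; linarith
    · have : cubic q₂ q₃ m = 0 := by rw [hf, h]; ring
      linarith
  exact ⟨hneg_m.1, hneg_m.2, hm_gt, hm_lt⟩

end Targets

end Summit.KontsevichZagierPeriods.HermiteRigidity.EllipticMomentKernelNegative
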